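import Literature.MathematicalPhysics.QuantumFieldTheory.OSSkeletonFunctional
import Literature.Analysis.Complex.FlatTubeFourier
import Literature.Analysis.Complex.HolomorphicParametricIntegral
import Mathlib.MeasureTheory.Function.JacobianOneDim
import HarnessLib

/-!
# Analyticity of the skeleton Schwinger function in the logarithmic gap variables (OS II, Ch. V, Method A, stage 1)

Topic `Literature/MathematicalPhysics/QuantumFieldTheory`; sequel of `OSSkeletonFunctional`.
Osterwalder–Schrader II (Comm. Math. Phys. 42 (1975)), Ch. V: the difference-variable Schwinger
functions, smeared in space, continue analytically and *jointly* in all the time differences —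
"all the `T_{iμ}` analytically continue the same distribution `T`. It follows now from the
Malgrange-Zerner theorem … that there is an analytic function … analytic in the convex envelope
of the union of all the flat tubes" (p. 292). This file carries out that step for the **skeleton
Schwinger function** `𝒮` of `OSSkeletonFunctional` (every point a fixed one-point test function
— a short time profile times a spatial test function — moved to prescribed times), in the
logarithmic variables `sᵢ = log(tᵢ - w')` of the gaps beyond the separation `w'`:

* `logW b θ` — the weight `u ↦ e^{-b log²u} θ(log u) / u` on `(0, ∞)` (a Gaussian-windowed
  profile `e^{-bs²} θ(s)` in `s = log u`), its measurability, bounds and integrability against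
  polynomials (`integrable_norm_logW_mul_pow`);
* `skelT` — the **skeleton functional** `T(θ) = ∫ (∏ᵢ logW b θᵢ (uᵢ)) 𝒮(w' + u) du` on tuples of
  profiles, the object to which the flat tube theorem applies;
* the **slot structure** (`skelT_update_eq`): freezing the other profiles, slot `i` of `T` is
  `ϑ ↦ ∫ gᵢ(s) e^{-bs²} ϑ(s) ds` with `gᵢ(s) = Qᵢ(eˢ)`, where
  `Qᵢ(τ) = ∫ (∏_{i'≠i} logW) · slotExt (w' + u') τ du'` (`slotInt`) is **holomorphic on
  `{Re τ > 0}`** (dominated holomorphic parameter integral over the holomorphic slot functions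
  `⟪v(Pᵢ), e^{-τH} v(Rᵢ)⟫` of `OSSkeletonFunctional`) and bounded there; so `gᵢ` is holomorphic and
  bounded in the strip `{|Im s| < π/2}`;
* `exists_holomorphic_skelT` — **the theorem**: there is `F` holomorphic on the tube
  `{∑ᵢ |Im zᵢ| < π/2}` over the `ℓ¹`-ball, bounded on closed sub-tubes, with
  `T(e^{-b·²}ϑ₀, …, e^{-b·²}ϑ_k) = ∫ F(x) ∏ᵢ ϑᵢ(xᵢ) dx` for all Schwartz `ϑᵢ` — the joint analytic
  continuation of the (windowed) skeleton Schwinger function in all logarithmic gap variables,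
  by `Literature.Analysis.Complex.exists_holomorphic_extension_l1Tube`.

The pointwise identification `F(x) = e^{-2b∑xᵢ²} 𝒮(w' + eˣ)` and the removal of the profiles
are left to the sequel.

## References

* K. Osterwalder, R. Schrader, *Axioms for Euclidean Green's functions II*, Comm. Math. Phys.
  42 (1975) 281–305, Ch. V pp. 289–292, (5.4), (5.7)–(5.8). [OsterwalderSchraderCMP1975]
-/

noncomputable section

open MeasureTheory Set Filter Real
open _root_.Topology
open scoped InnerProductSpace NNReal ComplexConjugate SchwartzMap

namespace Literature.MathematicalPhysics.QuantumFieldTheory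

variable {d : ℕ} [NeZero d]

open Literature.MathematicalPhysics.QuantumLattice (SchwingerFamily IsPositiveTimeMulti)
open Literature.MathematicalPhysics.QuantumLattice.SchwingerFamily
open Literature.MathematicalPhysics.QuantumLattice.SchwingerFamily.OSSpace

/-! ### The logarithmic weight -/

/-- The **logarithmic weight** of a profile `θ` with Gaussian window `b`:
`logW b θ u = e^{-b log²u} θ(log u) / u` for `u > 0`, `0` for `u ≤ 0`. [folklore] -/
def logW (b : ℝ) (θ : ℝ → ℂ) (u : ℝ) : ℂ :=
  if 0 < u then Complex.exp (-(b : ℂ) * (Real.log u : ℂ) ^ 2) * θ (Real.log u) / (u : ℂ) else 0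

/-- The weight vanishes on `(-∞, 0]`. [folklore] -/
theorem logW_of_nonpos {b : ℝ} {θ : ℝ → ℂ} {u : ℝ} (hu : u ≤ 0) : logW b θ u = 0 := by
  simp [logW, not_lt.2 hu]

/-- The weight on `(0, ∞)`. [folklore] -/
theorem logW_of_pos {b : ℝ} {θ : ℝ → ℂ} {u : ℝ} (hu : 0 < u) :
    logW b θ u = Complex.exp (-(b : ℂ) * (Real.log u : ℂ) ^ 2) * θ (Real.log u) / (u : ℂ) := by
  simp [logW, hu]

/-- The weight at `u = eˢ`: `logW b θ (eˢ) = e^{-bs²} θ(s) e^{-s}`. [folklore] -/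
theorem logW_exp {b : ℝ} (θ : ℝ → ℂ) (s : ℝ) :
    logW b θ (Real.exp s) = Complex.exp (-(b : ℂ) * (s : ℂ) ^ 2) * θ s / (Real.exp s : ℂ) := by
  rw [logW_of_pos (Real.exp_pos s), Real.log_exp]

/-- Norm of the weight on `(0, ∞)`. [folklore] -/
theorem norm_logW_of_pos {b : ℝ} {θ : ℝ → ℂ} {u : ℝ} (hu : 0 < u) :
    ‖logW b θ u‖ = Real.exp (-b * (Real.log u) ^ 2) * ‖θ (Real.log u)‖ / u := by
  rw [logW_of_pos hu, norm_div, norm_mul, Complex.norm_exp, Complex.norm_real, Real.norm_eq_abs,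
    abs_of_pos hu]
  congr 2
  have : (-(b : ℂ) * (Real.log u : ℂ) ^ 2) = ((-b * (Real.log u) ^ 2 : ℝ) : ℂ) := by push_cast; ring
  rw [this, Complex.ofReal_re]

/-- **Measurability of the weight** for a continuous profile. [folklore] -/
theorem measurable_logW {b : ℝ} {θ : ℝ → ℂ} (hθ : Continuous θ) : Measurable (logW b θ) := by
  unfold logW
  refine Measurable.ite measurableSet_Ioi ?_ measurable_const
  refine ((Complex.continuous_exp.measurable.comp ?_).mul
    (hθ.measurable.comp Real.measurable_log)).div (Complex.measurable_ofReal)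
  exact (measurable_const.mul ((Complex.measurable_ofReal.comp Real.measurable_log).pow_const 2))

/-- The elementary bound `e^{-b L²} e^{cL} ≤ e^{c²/(4b)}` (`b > 0`). [folklore] -/
theorem exp_neg_mul_sq_mul_exp_le {b : ℝ} (hb : 0 < b) (c L : ℝ) :
    Real.exp (-b * L ^ 2) * Real.exp (c * L) ≤ Real.exp (c ^ 2 / (4 * b)) := by
  rw [← Real.exp_add]
  refine Real.exp_le_exp.2 ?_
  have h : 0 ≤ b * (L - c / (2 * b)) ^ 2 := by positivity
  have h2 : b * (L - c / (2 * b)) ^ 2 = b * L ^ 2 - c * L + c ^ 2 / (4 * b) := by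
    field_simp
    ring
  linarith

/-- **The windowed weight against a polynomial is integrable on `(0, ∞)`**:
`u ↦ e^{-b log²u} (1 + u)ᴺ / u` is integrable on `(0, ∞)` (`b > 0`). On `(0, 1]` it is bounded by
`2ᴺ e^{1/(4b)}` (`e^{-b log²u}/u = e^{-bL² - L}`, `L = log u`), on `[1, ∞)` by
`2ᴺ e^{(N+1)²/(4b)} u⁻²`. [folklore] -/
theorem integrableOn_exp_neg_mul_log_sq {b : ℝ} (hb : 0 < b) (N : ℕ) :
    IntegrableOn (fun u : ℝ => Real.exp (-b * (Real.log u) ^ 2) * (1 + u) ^ N / u) (Ioi 0) := by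
  have hcont : ContinuousOn (fun u : ℝ => Real.exp (-b * (Real.log u) ^ 2) * (1 + u) ^ N / u) (Ioi 0) := by
    refine ContinuousOn.div ?_ continuousOn_id fun u hu => ne_of_gt hu
    exact ((Real.continuous_exp.comp_continuousOn ((continuousOn_const.mul
      ((Real.continuousOn_log.mono fun u hu => ne_of_gt hu).pow 2)))).mul
      (Continuous.continuousOn (by fun_prop)))
  -- split at `1`
  have hsplit : Ioi (0 : ℝ) = Ioc 0 1 ∪ Ioi 1 := (Ioc_union_Ioi_eq_Ioi zero_le_one).symm
  rw [hsplit]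
  refine IntegrableOn.union ?_ ?_
  · -- bounded by a constant on `(0, 1]`
    refine IntegrableOn.of_bound (μ := volume) measure_Ioc_lt_top
      ((hcont.mono Ioc_subset_Ioi_self).aestronglyMeasurable measurableSet_Ioc)
      (2 ^ N * Real.exp (1 ^ 2 / (4 * b))) ?_
    rw [ae_restrict_iff' measurableSet_Ioc]
    refine Eventually.of_forall fun u hu => ?_
    have hu0 : 0 < u := hu.1
    rw [Real.norm_eq_abs, abs_of_nonneg (by positivity)]
    have h1 : (1 + u) ^ N ≤ 2 ^ N := pow_le_pow_left₀ (by linarith) (by linarith [hu.2]) N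
    have h2 : Real.exp (-b * (Real.log u) ^ 2) / u ≤ Real.exp (1 ^ 2 / (4 * b)) := by
      have hu' : u = Real.exp (Real.log u) := (Real.exp_log hu0).symm
      have h3 := exp_neg_mul_sq_mul_exp_le hb (-1) (Real.log u)
      rw [show (-1 : ℝ) * Real.log u = -Real.log u by ring, Real.exp_neg, ← hu'] at h3
      rwa [div_eq_mul_inv, show ((-1 : ℝ)) ^ 2 = 1 ^ 2 by norm_num] at *
    calc Real.exp (-b * (Real.log u) ^ 2) * (1 + u) ^ N / u
        = (1 + u) ^ N * (Real.exp (-b * (Real.log u) ^ 2) / u) := by ring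
      _ ≤ 2 ^ N * Real.exp (1 ^ 2 / (4 * b)) :=
          mul_le_mul h1 h2 (by positivity) (by positivity)
  · -- bounded by a multiple of `u⁻²` on `[1, ∞)`
    have hint : IntegrableOn (fun u : ℝ => 2 ^ N * Real.exp (((N : ℝ) + 1) ^ 2 / (4 * b)) * u ^ (-(2 : ℝ))) (Ioi 1) :=
      ((integrableOn_Ioi_rpow_of_lt (by norm_num) zero_lt_one).const_mul _)
    refine hint.mono' ((hcont.mono (Ioi_subset_Ioi zero_le_one)).aestronglyMeasurable measurableSet_Ioi) ?_
    rw [ae_restrict_iff' measurableSet_Ioi]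
    refine Eventually.of_forall fun u (hu : 1 < u) => ?_
    have hu0 : 0 < u := by linarith
    rw [Real.norm_eq_abs, abs_of_nonneg (by positivity)]
    have hL : 0 ≤ Real.log u := Real.log_nonneg hu.le
    have h1 : (1 + u) ^ N ≤ 2 ^ N * u ^ N := by
      rw [← mul_pow]; exact pow_le_pow_left₀ (by linarith) (by linarith) N
    -- `u^{N+1} e^{-b log²u} ≤ e^{(N+1)²/(4b)}`
    have h2 : Real.exp (-b * (Real.log u) ^ 2) * u ^ (N + 1) ≤ Real.exp (((N : ℝ) + 1) ^ 2 / (4 * b)) := by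
      have h3 := exp_neg_mul_sq_mul_exp_le hb ((N : ℝ) + 1) (Real.log u)
      have h4 : Real.exp (((N : ℝ) + 1) * Real.log u) = u ^ (N + 1) := by
        rw [← Real.log_rpow hu0, Real.exp_log (Real.rpow_pos_of_pos hu0 _)]
        norm_cast
      rwa [h4] at h3
    have hu2 : u ^ (-(2 : ℝ)) = (u ^ 2)⁻¹ := by
      rw [Real.rpow_neg hu0.le, show (2 : ℝ) = ((2 : ℕ) : ℝ) by norm_num, Real.rpow_natCast]
    rw [hu2, div_le_iff₀ hu0]
    calc Real.exp (-b * (Real.log u) ^ 2) * (1 + u) ^ N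
        ≤ Real.exp (-b * (Real.log u) ^ 2) * (2 ^ N * u ^ N) :=
          mul_le_mul_of_nonneg_left h1 (Real.exp_pos _).le
      _ = 2 ^ N * (Real.exp (-b * (Real.log u) ^ 2) * u ^ (N + 1)) * (u ^ 2)⁻¹ * u := by
          field_simp
          ring
      _ ≤ 2 ^ N * Real.exp (((N : ℝ) + 1) ^ 2 / (4 * b)) * (u ^ 2)⁻¹ * u := by
          gcongr

/-- **Integrability of the weight against polynomials**: for a bounded continuous profile `θ`,
`u ↦ ‖logW b θ u‖ (1 + |u|)ᴺ` is integrable on `ℝ`. [folklore] -/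
theorem integrable_norm_logW_mul_pow {b : ℝ} (hb : 0 < b) {θ : ℝ → ℂ} (hθ : Continuous θ)
    {M : ℝ} (hM : ∀ s, ‖θ s‖ ≤ M) (N : ℕ) :
    Integrable fun u : ℝ => ‖logW b θ u‖ * (1 + |u|) ^ N := by
  have hM0 : 0 ≤ M := (norm_nonneg _).trans (hM 0)
  -- supported in `(0, ∞)`
  have hsupp : (fun u : ℝ => ‖logW b θ u‖ * (1 + |u|) ^ N) =
      (Ioi (0 : ℝ)).indicator fun u => ‖logW b θ u‖ * (1 + |u|) ^ N := by
    funext u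
    by_cases hu : 0 < u
    · rw [indicator_of_mem (mem_Ioi.2 hu)]
    · rw [indicator_of_notMem (fun h => hu (mem_Ioi.1 h)), logW_of_nonpos (not_lt.1 hu), norm_zero,
        zero_mul]
  rw [hsupp, integrable_indicator_iff measurableSet_Ioi]
  refine ((integrableOn_exp_neg_mul_log_sq hb N).const_mul M).mono' ?_ ?_
  · exact (((measurable_logW hθ).norm.mul (by fun_prop)).aestronglyMeasurable).restrict
  · rw [ae_restrict_iff' measurableSet_Ioi]
    refine Eventually.of_forall fun u (hu : 0 < u) => ?_
    rw [Real.norm_eq_abs, abs_of_nonneg (by positivity), norm_logW_of_pos hu, abs_of_pos hu]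
    calc Real.exp (-b * (Real.log u) ^ 2) * ‖θ (Real.log u)‖ / u * (1 + u) ^ N
        = ‖θ (Real.log u)‖ * (Real.exp (-b * (Real.log u) ^ 2) * (1 + u) ^ N / u) := by ring
      _ ≤ M * (Real.exp (-b * (Real.log u) ^ 2) * (1 + u) ^ N / u) :=
          mul_le_mul_of_nonneg_right (hM _) (by positivity)

/-- The weight is bounded: `‖logW b θ u‖ ≤ M e^{1/(4b)}`. [folklore] -/
theorem norm_logW_le {b : ℝ} (hb : 0 < b) {θ : ℝ → ℂ} {M : ℝ} (hM : ∀ s, ‖θ s‖ ≤ M) (u : ℝ) :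
    ‖logW b θ u‖ ≤ M * Real.exp (1 ^ 2 / (4 * b)) := by
  have hM0 : 0 ≤ M := (norm_nonneg _).trans (hM 0)
  rcases le_or_gt u 0 with hu | hu
  · rw [logW_of_nonpos hu, norm_zero]; positivity
  · rw [norm_logW_of_pos hu]
    have hu' : u = Real.exp (Real.log u) := (Real.exp_log hu).symm
    have h3 := exp_neg_mul_sq_mul_exp_le hb (-1) (Real.log u)
    rw [show (-1 : ℝ) * Real.log u = -Real.log u by ring, Real.exp_neg, ← hu',
      show ((-1 : ℝ)) ^ 2 = 1 ^ 2 by norm_num] at h3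
    calc Real.exp (-b * (Real.log u) ^ 2) * ‖θ (Real.log u)‖ / u
        = ‖θ (Real.log u)‖ * (Real.exp (-b * (Real.log u) ^ 2) * u⁻¹) := by ring
      _ ≤ M * Real.exp (1 ^ 2 / (4 * b)) := mul_le_mul (hM _) h3 (by positivity) hM0

/-- At modulated Gaussians the weight has a modulus independent of the frequency. [folklore] -/
theorem norm_logW_gaussMod (b p u : ℝ) :
    ‖logW b (fun s : ℝ => Complex.exp (-(b : ℂ) * (s : ℂ) ^ 2) * Complex.exp (↑(-2 * π * s * p) * Complex.I)) u‖ =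
      ‖logW b (fun s : ℝ => Complex.exp (-(b : ℂ) * (s : ℂ) ^ 2)) u‖ := by
  rcases le_or_gt u 0 with hu | hu
  · rw [logW_of_nonpos hu, logW_of_nonpos hu]
  · rw [norm_logW_of_pos hu, norm_logW_of_pos hu, norm_mul, Complex.norm_exp_ofReal_mul_I, mul_one]

/-! ### The skeleton functional -/

section Functional

variable (𝔖 : SchwingerFamily (EuclideanSpace ℝ (Fin d))) {k : ℕ}
  (φ : Fin (k + 2) → 𝓢(EuclideanSpace ℝ (Fin d), ℂ)) (w' : ℝ) (b : ℝ)

/-- The skeleton Schwinger function in the gaps beyond the separation: `𝒮'(u) = 𝒮(w' + u)`. [folklore] -/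
def skelS' (u : Fin (k + 1) → ℝ) : ℂ := skelS 𝔖 φ fun i => w' + u i

/-- The product weight `∏ᵢ logW b θᵢ (uᵢ)`. [folklore] -/
def wprod (θ : Fin (k + 1) → ℝ → ℂ) (u : Fin (k + 1) → ℝ) : ℂ := ∏ i, logW b (θ i) (u i)

/-- The **skeleton functional** `T(θ) = ∫ (∏ᵢ logW b θᵢ (uᵢ)) 𝒮(w' + u) du`. [cite: OsterwalderSchraderCMP1975, Ch. V p. 292] -/
def skelT (θ : Fin (k + 1) → ℝ → ℂ) : ℂ := ∫ u : Fin (k + 1) → ℝ, wprod b θ u * skelS' 𝔖 φ w' u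

variable {𝔖 φ w' b}

/-- Continuity of `𝒮'`. [folklore] -/
theorem continuous_skelS' : Continuous (skelS' 𝔖 φ w') :=
  (continuous_skelS 𝔖 φ).comp (continuous_pi fun i => continuous_const.add (continuous_apply i))

/-- `1 + ‖w' + u‖ ≤ (1 + |w'|)(1 + ‖u‖)`. [folklore] -/
theorem one_add_norm_const_add_le {ι : Type*} [Fintype ι] (w' : ℝ) (u : ι → ℝ) :
    1 + ‖fun i => w' + u i‖ ≤ (1 + |w'|) * (1 + ‖u‖) := by
  have h : ‖fun i => w' + u i‖ ≤ |w'| + ‖u‖ := by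
    refine (pi_norm_le_iff_of_nonneg (by positivity)).2 fun i => ?_
    rw [Real.norm_eq_abs]
    calc |w' + u i| ≤ |w'| + |u i| := abs_add_le _ _
      _ ≤ |w'| + ‖u‖ := by rw [← Real.norm_eq_abs (u i)]; exact add_le_add le_rfl (norm_le_pi_norm u i)
  nlinarith [norm_nonneg u, abs_nonneg w']

/-- Polynomial bound of `𝒮'`. [folklore] -/
theorem exists_norm_skelS'_le :
    ∃ (C : ℝ) (N : ℕ), 0 ≤ C ∧ ∀ u, ‖skelS' 𝔖 φ w' u‖ ≤ C * (1 + ‖u‖) ^ N := by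
  obtain ⟨C, N, hC, hb⟩ := exists_norm_skelS_le 𝔖 φ
  refine ⟨C * (1 + |w'|) ^ N, N, by positivity, fun u => (hb _).trans ?_⟩
  calc C * (1 + ‖fun i => w' + u i‖) ^ N ≤ C * ((1 + |w'|) * (1 + ‖u‖)) ^ N := by
        gcongr; exact one_add_norm_const_add_le w' u
    _ = C * (1 + |w'|) ^ N * (1 + ‖u‖) ^ N := by rw [mul_pow]; ring

/-- **Integrability of a product of weights of Schwartz profiles against a polynomially bounded
measurable function.** [folklore] -/
theorem integrable_prod_logW_mul {m : ℕ} (hb : 0 < b) (θ : Fin m → 𝓢(ℝ, ℂ)) {G : (Fin m → ℝ) → ℂ}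
    (hG : AEStronglyMeasurable G volume) {C : ℝ} {N : ℕ} (hC : ∀ u, ‖G u‖ ≤ C * (1 + ‖u‖) ^ N) :
    Integrable fun u : Fin m → ℝ => (∏ j, logW b (θ j) (u j)) * G u := by
  have hM : ∀ j, ∃ M, ∀ s, ‖θ j s‖ ≤ M := fun j =>
    ⟨SchwartzMap.seminorm ℂ 0 0 (θ j), fun s => SchwartzMap.norm_le_seminorm ℂ (θ j) s⟩
  choose M hM using hM
  have hint : Integrable fun u : Fin m → ℝ => ∏ j, (‖logW b (θ j) (u j)‖ * (1 + |u j|) ^ N) :=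
    Integrable.fintype_prod (f := fun j (x : ℝ) => ‖logW b (θ j) x‖ * (1 + |x|) ^ N)
      fun j => integrable_norm_logW_mul_pow hb (θ j).continuous (hM j) N
  have hmeas : Measurable fun u : Fin m → ℝ => ∏ j, logW b (θ j) (u j) :=
    Finset.measurable_prod _ fun j _ => (measurable_logW (θ j).continuous).comp (measurable_pi_apply j)
  refine (hint.const_mul |C|).mono' (hmeas.aestronglyMeasurable.mul hG) (Eventually.of_forall fun u => ?_)
  rw [norm_mul, norm_prod]
  have hC' : ‖G u‖ ≤ |C| * ∏ j, (1 + |u j|) ^ N :=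
    (hC u).trans ((mul_le_mul_of_nonneg_right (le_abs_self C) (by positivity)).trans
      (mul_le_mul_of_nonneg_left (Literature.Analysis.Complex.one_add_norm_pow_le_prod u N) (abs_nonneg C)))
  calc (∏ j, ‖logW b (θ j) (u j)‖) * ‖G u‖ ≤ (∏ j, ‖logW b (θ j) (u j)‖) * (|C| * ∏ j, (1 + |u j|) ^ N) :=
        mul_le_mul_of_nonneg_left hC' (Finset.prod_nonneg fun j _ => norm_nonneg _)
    _ = |C| * ∏ j, (‖logW b (θ j) (u j)‖ * (1 + |u j|) ^ N) := by rw [Finset.prod_mul_distrib]; ring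

/-- The integrand of the skeleton functional is integrable for Schwartz profiles. [folklore] -/
theorem integrable_wprod_mul_skelS' (hb : 0 < b) (θ : Fin (k + 1) → 𝓢(ℝ, ℂ)) :
    Integrable fun u : Fin (k + 1) → ℝ => wprod b (fun j => ⇑(θ j)) u * skelS' 𝔖 φ w' u := by
  obtain ⟨C, N, -, hC⟩ := exists_norm_skelS'_le (𝔖 := 𝔖) (φ := φ) (w' := w')
  exact integrable_prod_logW_mul hb θ continuous_skelS'.aestronglyMeasurable hC

/-! ### Slot `i`: Fubini -/

variable (i : Fin (k + 1))

/-- The product weight at `insertNth` with the profile `i` updated splits off the factor `i`. [folklore] -/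
theorem wprod_update_insertNth (θ : Fin (k + 1) → ℝ → ℂ) (ϑ : ℝ → ℂ) (x : ℝ) (u' : Fin k → ℝ) :
    wprod b (Function.update θ i ϑ) (i.insertNth x u') =
      logW b ϑ x * ∏ j, logW b (θ (i.succAbove j)) (u' j) := by
  rw [wprod, Fin.prod_univ_succAbove _ i, Fin.insertNth_apply_same, Function.update_self]
  congr 1
  refine Finset.prod_congr rfl fun j _ => ?_
  rw [Fin.insertNth_apply_succAbove, Function.update_of_ne (Fin.succAbove_ne i j)]

/-- **Fubini for the slot `i`**: with Schwartz profiles,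
`T(θ[i ↦ ϑ]) = ∫ logW b ϑ (x) (∫ (∏_{j} logW b θ_{σᵢ j} (u'ⱼ)) 𝒮'(insertNth i x u') du') dx`. [folklore] -/
theorem skelT_update_eq_integral_integral (hb : 0 < b) (θ : Fin (k + 1) → 𝓢(ℝ, ℂ)) (ϑ : 𝓢(ℝ, ℂ)) :
    skelT 𝔖 φ w' b (Function.update (fun j => ⇑(θ j)) i ϑ) =
      ∫ x : ℝ, logW b ϑ x * ∫ u' : Fin k → ℝ,
        (∏ j, logW b (θ (i.succAbove j)) (u' j)) * skelS' 𝔖 φ w' (i.insertNth x u') := by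
  -- the integrand, integrable
  have hθ' : Function.update (fun j => ⇑(θ j)) i ϑ = fun j => ⇑(Function.update θ i ϑ j) := by
    funext j
    by_cases hj : j = i
    · subst hj; simp
    · simp [Function.update_of_ne hj]
  have hint : Integrable fun u : Fin (k + 1) → ℝ =>
      wprod b (Function.update (fun j => ⇑(θ j)) i ϑ) u * skelS' 𝔖 φ w' u := by
    rw [hθ']
    exact integrable_wprod_mul_skelS' hb _
  -- change of variables along `piFinSuccAbove`
  set e := MeasurableEquiv.piFinSuccAbove (fun _ : Fin (k + 1) => ℝ) i with he
  have hmp : MeasurePreserving e (volume : Measure (Fin (k + 1) → ℝ))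
      ((volume : Measure ℝ).prod (volume : Measure (Fin k → ℝ))) := by
    have h := measurePreserving_piFinSuccAbove (fun _ : Fin (k + 1) => (volume : Measure ℝ)) i
    rwa [← volume_pi, ← volume_pi] at h
  rw [skelT, ← hmp.symm.integral_comp' (f := e.symm)]
  -- Fubini
  have hint' : Integrable (fun z : ℝ × (Fin k → ℝ) =>
      wprod b (Function.update (fun j => ⇑(θ j)) i ϑ) (e.symm z) * skelS' 𝔖 φ w' (e.symm z))
      ((volume : Measure ℝ).prod (volume : Measure (Fin k → ℝ))) :=
    hmp.symm.integrable_comp_emb e.symm.measurableEmbedding |>.2 hint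
  have hfun : (fun z : ℝ × (Fin k → ℝ) =>
      wprod b (Function.update (fun j => ⇑(θ j)) i ϑ) (e.symm z) * skelS' 𝔖 φ w' (e.symm z)) =
      fun z => logW b ϑ z.1 * ((∏ j, logW b (θ (i.succAbove j)) (z.2 j)) *
        skelS' 𝔖 φ w' (i.insertNth z.1 z.2)) := by
    funext z
    change wprod b (Function.update (fun j => ⇑(θ j)) i ϑ) (i.insertNth z.1 z.2) *
      skelS' 𝔖 φ w' (i.insertNth z.1 z.2) = _
    rw [wprod_update_insertNth, mul_assoc]
  rw [hfun] at hint' ⊢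
  rw [integral_prod _ hint']
  refine integral_congr_ae (Eventually.of_forall fun x => ?_)
  exact integral_const_mul (logW b ϑ x) _

end Functional

/-! ### The integrated slot function: holomorphy and bounds -/

section SlotInt

variable (𝔖 : SchwingerFamily (EuclideanSpace ℝ (Fin d))) (hE1 : 𝔖.IsEuclideanCovariant)
  (hE2 : 𝔖.IsOSReflectionPositive) {k : ℕ} (φ : Fin (k + 2) → 𝓢(EuclideanSpace ℝ (Fin d), ℂ))
  (i : Fin (k + 1)) {w' r : ℝ}
  (hφ : ∀ j, tsupport (φ j : EuclideanSpace ℝ (Fin d) → ℂ) ⊆ {y | |y 0| ≤ r}) (hw : 2 * r < w')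
  (hw0 : 0 ≤ w') (b : ℝ)

/-- The **integrated slot function**
`Qᵢ(τ) = ∫ (∏ⱼ logW b θ_{σᵢ j}(u'ⱼ)) ⟪v(Pᵢ(w' + u')), e^{-τH} v(Rᵢ(w' + u'))⟫ du'`. [cite: OsterwalderSchraderCMP1975, Ch. V eqs. (5.4), (5.7)] -/
def slotInt (θ : Fin (k + 1) → ℝ → ℂ) (τ : ℂ) : ℂ :=
  ∫ u' : Fin k → ℝ, (∏ j, logW b (θ (i.succAbove j)) (u' j)) *
    slotExt 𝔖 hE1 hE2 φ i hφ hw hw0 (fun j => w' + u' j) τ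

variable {𝔖 hE1 hE2 φ i hφ hw hw0 b}

/-- `w' + insertNth i x u' = insertNth i (w' + x) (w' + u')`. [folklore] -/
theorem const_add_insertNth (x : ℝ) (u' : Fin k → ℝ) :
    (fun i' : Fin (k + 1) => w' + (i.insertNth x u' : Fin (k + 1) → ℝ) i') =
      (i.insertNth (w' + x) (fun j => w' + u' j) : Fin (k + 1) → ℝ) := by
  funext i'
  rcases Fin.eq_self_or_eq_succAbove i i' with rfl | ⟨j, rfl⟩
  · simp [Fin.insertNth_apply_same]
  · simp [Fin.insertNth_apply_succAbove]

/-- **The inner integral of the Fubini split is the integrated slot function at real points**: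
for `x ≥ 0`, `∫ (∏ logW) 𝒮'(insertNth i x u') du' = Qᵢ(x)` (off the positive orthant of `u'` some
weight vanishes; on it the slot identity `slotExt_ofReal` applies). [folklore] -/
theorem integral_prod_logW_mul_skelS'_eq_slotInt (hr : 0 ≤ r) (θ : Fin (k + 1) → ℝ → ℂ) {x : ℝ}
    (hx : 0 ≤ x) :
    ∫ u' : Fin k → ℝ, (∏ j, logW b (θ (i.succAbove j)) (u' j)) * skelS' 𝔖 φ w' (i.insertNth x u') =
      slotInt 𝔖 hE1 hE2 φ i hφ hw hw0 b θ x := by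
  rw [slotInt]
  refine integral_congr_ae (Eventually.of_forall fun u' => ?_)
  by_cases hu : ∀ j, 0 < u' j
  · simp only
    rw [skelS', const_add_insertNth, slotExt_ofReal 𝔖 hE1 hE2 φ i hφ hw hw0 hr
      (fun j => by linarith [hu j]) hx]
  · push Not at hu
    obtain ⟨j, hj⟩ := hu
    have h0 : ∏ j, logW b (θ (i.succAbove j)) (u' j) = 0 :=
      Finset.prod_eq_zero (Finset.mem_univ j) (logW_of_nonpos hj)
    simp only [h0, zero_mul]

/-- **The domination of the slot integrand** for Schwartz profiles: integrability of
`u' ↦ (∏ⱼ ‖logW b θ_{σᵢ j} (u'ⱼ)‖) C (1 + ‖w' + u'‖)ᴺ`. [folklore] -/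
theorem integrable_prod_norm_logW_mul_pow (hb : 0 < b) (θ : Fin (k + 1) → 𝓢(ℝ, ℂ)) {C : ℝ} (hC : 0 ≤ C)
    (N : ℕ) :
    Integrable fun u' : Fin k → ℝ =>
      (∏ j, ‖logW b (θ (i.succAbove j)) (u' j)‖) * (C * (1 + ‖fun j => w' + u' j‖) ^ N) := by
  have hM : ∀ j, ∃ M, ∀ s, ‖θ j s‖ ≤ M := fun j =>
    ⟨SchwartzMap.seminorm ℂ 0 0 (θ j), fun s => SchwartzMap.norm_le_seminorm ℂ (θ j) s⟩
  choose M hM using hM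
  have hint : Integrable fun u' : Fin k → ℝ => ∏ j, (‖logW b (θ (i.succAbove j)) (u' j)‖ * (1 + |u' j|) ^ N) :=
    Integrable.fintype_prod (f := fun j (x : ℝ) => ‖logW b (θ (i.succAbove j)) x‖ * (1 + |x|) ^ N)
      fun j => integrable_norm_logW_mul_pow hb (θ _).continuous (hM _) N
  have hmeas : Measurable fun u' : Fin k → ℝ => ∏ j, ‖logW b (θ (i.succAbove j)) (u' j)‖ :=
    Finset.measurable_prod _ fun j _ =>
      ((measurable_logW (θ _).continuous).comp (measurable_pi_apply j)).norm
  refine (hint.const_mul (C * (1 + |w'|) ^ N)).mono' ?_ (Eventually.of_forall fun u' => ?_)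
  · exact (hmeas.mul (measurable_const.mul ((measurable_const.add (continuous_norm.measurable.comp
      (measurable_pi_lambda _ fun j => measurable_const.add (measurable_pi_apply j)))).pow_const N))).aestronglyMeasurable
  rw [Real.norm_eq_abs, abs_of_nonneg (mul_nonneg (Finset.prod_nonneg fun j _ => norm_nonneg _) (by positivity))]
  have h1 : (1 + ‖fun j => w' + u' j‖) ^ N ≤ (1 + |w'|) ^ N * ∏ j, (1 + |u' j|) ^ N := by
    calc (1 + ‖fun j => w' + u' j‖) ^ N ≤ ((1 + |w'|) * (1 + ‖u'‖)) ^ N :=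
          pow_le_pow_left₀ (by positivity) (one_add_norm_const_add_le w' u') N
      _ = (1 + |w'|) ^ N * (1 + ‖u'‖) ^ N := mul_pow _ _ _
      _ ≤ (1 + |w'|) ^ N * ∏ j, (1 + |u' j|) ^ N :=
          mul_le_mul_of_nonneg_left (Literature.Analysis.Complex.one_add_norm_pow_le_prod u' N) (by positivity)
  calc (∏ j, ‖logW b (θ (i.succAbove j)) (u' j)‖) * (C * (1 + ‖fun j => w' + u' j‖) ^ N)
      ≤ (∏ j, ‖logW b (θ (i.succAbove j)) (u' j)‖) * (C * ((1 + |w'|) ^ N * ∏ j, (1 + |u' j|) ^ N)) := by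
        gcongr
    _ = C * (1 + |w'|) ^ N * ∏ j, (‖logW b (θ (i.succAbove j)) (u' j)‖ * (1 + |u' j|) ^ N) := by
        rw [Finset.prod_mul_distrib]; ring

/-- The **slot bound** `Bᵢ(θ) = ∫ (∏ⱼ ‖logW b θ_{σᵢ j}(u'ⱼ)‖) C (1 + ‖w' + u'‖)ᴺ du'` attached to
constants `C, N` of a polynomial bound of the slot functions (independent of the point of the
strip). [folklore] -/
def slotB {k : ℕ} (i : Fin (k + 1)) (w' b C : ℝ) (N : ℕ) (θ : Fin (k + 1) → ℝ → ℂ) : ℝ :=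
  ∫ u' : Fin k → ℝ, (∏ j, ‖logW b (θ (i.succAbove j)) (u' j)‖) * (C * (1 + ‖fun j => w' + u' j‖) ^ N)

/-- Measurability of the slot integrand in the other gaps. [folklore] -/
theorem aestronglyMeasurable_slot_integrand (θ : Fin (k + 1) → 𝓢(ℝ, ℂ)) (τ : ℂ) :
    AEStronglyMeasurable (fun u' : Fin k → ℝ => (∏ j, logW b (θ (i.succAbove j)) (u' j)) *
      slotExt 𝔖 hE1 hE2 φ i hφ hw hw0 (fun j => w' + u' j) τ) volume := by
  have hmeas : Measurable fun u' : Fin k → ℝ => ∏ j, logW b (θ (i.succAbove j)) (u' j) :=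
    Finset.measurable_prod _ fun j _ => (measurable_logW (θ _).continuous).comp (measurable_pi_apply j)
  exact hmeas.aestronglyMeasurable.mul (((continuous_slotExt_left 𝔖 hE1 hE2 φ i hφ hw hw0 τ).comp
    (continuous_pi fun j => continuous_const.add (continuous_apply j))).aestronglyMeasurable)

variable {C : ℝ} {N : ℕ}
  (hCN : ∀ (t' : Fin k → ℝ) (τ : ℂ), 0 ≤ τ.re → ‖slotExt 𝔖 hE1 hE2 φ i hφ hw hw0 t' τ‖ ≤ C * (1 + ‖t'‖) ^ N)

include hCN

/-- **The domination of the slot integrand**: for `Re τ ≥ 0`,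
`‖(∏ logW) slotExt (w' + u') τ‖ ≤ (∏ ‖logW‖) C (1 + ‖w' + u'‖)ᴺ`. [folklore] -/
theorem norm_slot_integrand_le (θ : Fin (k + 1) → ℝ → ℂ) {τ : ℂ} (hτ : 0 ≤ τ.re) (u' : Fin k → ℝ) :
    ‖(∏ j, logW b (θ (i.succAbove j)) (u' j)) * slotExt 𝔖 hE1 hE2 φ i hφ hw hw0 (fun j => w' + u' j) τ‖ ≤
      (∏ j, ‖logW b (θ (i.succAbove j)) (u' j)‖) * (C * (1 + ‖fun j => w' + u' j‖) ^ N) := by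
  rw [norm_mul, norm_prod]
  exact mul_le_mul_of_nonneg_left (hCN _ τ hτ) (Finset.prod_nonneg fun j _ => norm_nonneg _)

/-- **Holomorphy of the integrated slot function** on `{Re τ > 0}` (dominated holomorphic parameter
integral). [cite: OsterwalderSchraderCMP1975, Ch. V eqs. (5.4), (5.7)] -/
theorem differentiableOn_slotInt (hb : 0 < b) (hC : 0 ≤ C) (θ : Fin (k + 1) → 𝓢(ℝ, ℂ)) :
    DifferentiableOn ℂ (slotInt 𝔖 hE1 hE2 φ i hφ hw hw0 b fun j => ⇑(θ j)) {τ : ℂ | 0 < τ.re} := by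
  set U : Set ℂ := {τ : ℂ | 0 < τ.re} with hU
  set F : ℂ → (Fin k → ℝ) → ℂ := fun τ u' => (∏ j, logW b (θ (i.succAbove j)) (u' j)) *
    slotExt 𝔖 hE1 hE2 φ i hφ hw hw0 (fun j => w' + u' j) τ with hF
  have hslot : (slotInt 𝔖 hE1 hE2 φ i hφ hw hw0 b fun j => ⇑(θ j)) = fun τ => ∫ u', F τ u' := rfl
  rw [hslot]
  have hmeas : ∀ τ ∈ U, AEStronglyMeasurable (F τ) volume := fun τ _ =>
    aestronglyMeasurable_slot_integrand θ τ
  have hdiff : ∀ᵐ u' ∂(volume : Measure (Fin k → ℝ)), DifferentiableOn ℂ (fun τ => F τ u') U :=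
    Eventually.of_forall fun u' =>
      (differentiableOn_const (∏ j, logW b (θ (i.succAbove j)) (u' j))).mul
        (differentiableOn_slotExt 𝔖 hE1 hE2 φ i hφ hw hw0 fun j => w' + u' j)
  have hdom : ∀ τ₀ ∈ U, ∃ R : ℝ, 0 < R ∧ Metric.ball τ₀ R ⊆ U ∧ ∃ bound : (Fin k → ℝ) → ℝ,
      Integrable bound volume ∧ ∀ᵐ u' ∂(volume : Measure (Fin k → ℝ)), ∀ τ ∈ Metric.ball τ₀ R,
        ‖F τ u'‖ ≤ bound u' := by
    intro τ₀ hτ₀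
    have hτ₀' : 0 < τ₀.re := hτ₀
    have hball : ∀ τ ∈ Metric.ball τ₀ (τ₀.re / 2), 0 < τ.re := by
      intro τ hτ
      have h := mem_ball_iff_norm.1 hτ
      have h2 : |τ.re - τ₀.re| < τ₀.re / 2 := by
        calc |τ.re - τ₀.re| = |(τ - τ₀).re| := by simp
          _ ≤ ‖τ - τ₀‖ := Complex.abs_re_le_norm _
          _ < τ₀.re / 2 := h
      rcases abs_lt.1 h2 with ⟨h3, -⟩
      linarith
    exact ⟨τ₀.re / 2, by positivity, fun τ hτ => hball τ hτ,
      fun u' => (∏ j, ‖logW b (θ (i.succAbove j)) (u' j)‖) * (C * (1 + ‖fun j => w' + u' j‖) ^ N),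
      integrable_prod_norm_logW_mul_pow hb θ hC N,
      Eventually.of_forall fun u' τ hτ => norm_slot_integrand_le hCN (fun j => ⇑(θ j)) (hball τ hτ).le u'⟩
  exact Literature.Analysis.Complex.differentiableOn_integral_of_dominated hmeas hdiff hdom

/-- **Bound of the integrated slot function** on `{Re τ ≥ 0}`: `‖Qᵢ(τ)‖ ≤ Bᵢ(θ)`. [folklore] -/
theorem norm_slotInt_le (hb : 0 < b) (hC : 0 ≤ C) (θ : Fin (k + 1) → 𝓢(ℝ, ℂ)) {τ : ℂ} (hτ : 0 ≤ τ.re) :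
    ‖slotInt 𝔖 hE1 hE2 φ i hφ hw hw0 b (fun j => ⇑(θ j)) τ‖ ≤ slotB i w' b C N fun j => ⇑(θ j) :=
  norm_integral_le_of_norm_le (integrable_prod_norm_logW_mul_pow hb θ hC N)
    (Eventually.of_forall fun u' => norm_slot_integrand_le hCN (fun j => ⇑(θ j)) hτ u')

/-! ### The slot function in the logarithmic variable -/

omit hCN in
/-- The exponential maps the strip `{|Im z| < π/2}` into the right half-plane. [folklore] -/
theorem exp_re_pos_of_abs_im_lt {z : ℂ} (hz : |z.im| < π / 2) : 0 < (Complex.exp z).re := by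
  rw [Complex.exp_re]
  exact mul_pos (Real.exp_pos _) (Real.cos_pos_of_mem_Ioo (abs_lt.1 hz))

omit hCN in
/-- The exponential maps the closed strip `{|Im z| ≤ π/2}` into the closed right half-plane. [folklore] -/
theorem exp_re_nonneg_of_abs_im_le {z : ℂ} (hz : |z.im| ≤ π / 2) : 0 ≤ (Complex.exp z).re := by
  rw [Complex.exp_re]
  exact mul_nonneg (Real.exp_pos _).le (Real.cos_nonneg_of_mem_Icc (abs_le.1 hz))

/-- **The slot function in the logarithmic variable, `gᵢ(z) = Qᵢ(eᶻ)`, is holomorphic in the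
strip `{|Im z| < π/2}` and bounded by `Bᵢ(θ)` on its closure.** [cite: OsterwalderSchraderCMP1975, Ch. V p. 292] -/
theorem slot_log_holomorphic (hb : 0 < b) (hC : 0 ≤ C) (θ : Fin (k + 1) → 𝓢(ℝ, ℂ)) :
    DifferentiableOn ℂ (fun z => slotInt 𝔖 hE1 hE2 φ i hφ hw hw0 b (fun j => ⇑(θ j)) (Complex.exp z))
        {z : ℂ | |z.im| < π / 2} ∧
      ∀ c : ℝ, c < π / 2 → ∀ z : ℂ, |z.im| ≤ c →
        ‖slotInt 𝔖 hE1 hE2 φ i hφ hw hw0 b (fun j => ⇑(θ j)) (Complex.exp z)‖ ≤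
          slotB i w' b C N (fun j => ⇑(θ j)) * Real.exp (0 * |z.re|) := by
  refine ⟨(differentiableOn_slotInt hCN hb hC θ).comp Complex.differentiable_exp.differentiableOn
    fun z hz => exp_re_pos_of_abs_im_lt hz, fun c hc z hz => ?_⟩
  rw [zero_mul, Real.exp_zero, mul_one]
  exact norm_slotInt_le hCN hb hC θ (exp_re_nonneg_of_abs_im_le (hz.trans hc.le))

omit hCN in
/-- **The one-dimensional substitution `u = eˢ`**: `∫ logW b ϑ (u) q(u) du = ∫ e^{-bs²} ϑ(s) q(eˢ) ds`
for any `q` (the weight vanishes on `(-∞, 0]`). [folklore] -/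
theorem integral_logW_mul_eq (b : ℝ) (ϑ : ℝ → ℂ) (q : ℝ → ℂ) :
    ∫ u : ℝ, logW b ϑ u * q u = ∫ s : ℝ, q (Real.exp s) * Complex.exp (-(b : ℂ) * (s : ℂ) ^ 2) * ϑ s := by
  have h1 : ∫ u : ℝ, logW b ϑ u * q u = ∫ u in Ioi (0 : ℝ), logW b ϑ u * q u := by
    refine (setIntegral_eq_integral_of_forall_compl_eq_zero fun u hu => ?_).symm
    rw [logW_of_nonpos (not_lt.1 fun h => hu (mem_Ioi.2 h)), zero_mul]
  have h2 := integral_image_eq_integral_abs_deriv_smul (f := Real.exp) (f' := Real.exp) (s := univ)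
    MeasurableSet.univ (fun x _ => (Real.hasDerivAt_exp x).hasDerivWithinAt) Real.exp_injective.injOn
    (fun u => logW b ϑ u * q u)
  rw [image_univ, Real.range_exp, Measure.restrict_univ] at h2
  rw [h1, h2]
  refine integral_congr_ae (Eventually.of_forall fun s => ?_)
  simp only [logW_exp, abs_of_pos (Real.exp_pos s), Complex.real_smul, Complex.ofReal_exp]
  have hne : Complex.exp (s : ℂ) ≠ 0 := Complex.exp_ne_zero _
  field_simp

end SlotInt

/-! ### The theorem -/

section Main

variable (𝔖 : SchwingerFamily (EuclideanSpace ℝ (Fin d))) {k : ℕ}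
  (φ : Fin (k + 2) → 𝓢(EuclideanSpace ℝ (Fin d), ℂ)) {w' r : ℝ} (hr : 0 ≤ r) {b : ℝ} (hb : 0 < b)

include hr hb

/-- **The slot representations of the skeleton functional** (the hypothesis `hT` of the flat tube
theorem): slot `i` of `T` at Schwartz profiles is `ϑ ↦ ∫ gᵢ(s) e^{-bs²} ϑ(s) ds` with `gᵢ(z) = Qᵢ(eᶻ)`
holomorphic in `{|Im z| < π/2}` and bounded by `Bᵢ(θ)`. [cite: OsterwalderSchraderCMP1975, Ch. V p. 292] -/
theorem skelT_slot (hE1 : 𝔖.IsEuclideanCovariant) (hE2 : 𝔖.IsOSReflectionPositive)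
    (hφ : ∀ j, tsupport (φ j : EuclideanSpace ℝ (Fin d) → ℂ) ⊆ {y | |y 0| ≤ r}) (hw : 2 * r < w')
    (hw0 : 0 ≤ w') (i : Fin (k + 1)) {C : ℝ} {N : ℕ} (hC : 0 ≤ C)
    (hCN : ∀ (t' : Fin k → ℝ) (τ : ℂ), 0 ≤ τ.re → ‖slotExt 𝔖 hE1 hE2 φ i hφ hw hw0 t' τ‖ ≤ C * (1 + ‖t'‖) ^ N)
    (θ : Fin (k + 1) → 𝓢(ℝ, ℂ)) :
    ∃ g : ℂ → ℂ, DifferentiableOn ℂ g {z : ℂ | |z.im| < π / 2} ∧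
      (∀ c : ℝ, c < π / 2 → ∀ z : ℂ, |z.im| ≤ c →
        ‖g z‖ ≤ slotB i w' b C N (fun j => ⇑(θ j)) * Real.exp (0 * |z.re|)) ∧
      ∀ ϑ : 𝓢(ℝ, ℂ), skelT 𝔖 φ w' b (Function.update (fun j => ⇑(θ j)) i ϑ) =
        ∫ s : ℝ, g s * Complex.exp (-(b : ℂ) * (s : ℂ) ^ 2) * ϑ s := by
  obtain ⟨hdiff, hbound⟩ := slot_log_holomorphic hCN hb hC θ
  refine ⟨_, hdiff, hbound, fun ϑ => ?_⟩
  rw [skelT_update_eq_integral_integral i hb θ ϑ]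
  have h1 : (fun x : ℝ => logW b ϑ x * ∫ u' : Fin k → ℝ, (∏ j, logW b (θ (i.succAbove j)) (u' j)) *
      skelS' 𝔖 φ w' (i.insertNth x u')) =
      fun x => logW b ϑ x * slotInt 𝔖 hE1 hE2 φ i hφ hw hw0 b (fun j => ⇑(θ j)) x := by
    funext x
    rcases le_or_gt x 0 with hx | hx
    · rw [logW_of_nonpos hx, zero_mul, zero_mul]
    · rw [integral_prod_logW_mul_skelS'_eq_slotInt (hE1 := hE1) (hE2 := hE2) (hφ := hφ) (hw := hw)
        (hw0 := hw0) (b := b) hr (fun j => ⇑(θ j)) hx.le]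
  rw [h1, integral_logW_mul_eq]
  refine integral_congr_ae (Eventually.of_forall fun s => ?_)
  beta_reduce
  rw [Complex.ofReal_exp]

omit hr hb in
/-- **The slot bounds at modulated Gaussians do not depend on the frequencies** (the hypothesis
`hB` of the flat tube theorem, with exponent `0`). [folklore] -/
theorem slotB_gaussMod_eq (i : Fin (k + 1)) (C : ℝ) (N : ℕ) (p : Fin (k + 1) → ℝ) :
    slotB i w' b C N (fun j (s : ℝ) => Complex.exp (-(b : ℂ) * (s : ℂ) ^ 2) *
        Complex.exp (↑(-2 * π * s * p j) * Complex.I)) =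
      slotB i w' b C N (fun _ (s : ℝ) => Complex.exp (-(b : ℂ) * (s : ℂ) ^ 2)) := by
  refine integral_congr_ae (Eventually.of_forall fun u' => ?_)
  simp only [norm_logW_gaussMod]

/-- **Joint analyticity of the skeleton Schwinger function in the logarithmic gap variables**
(Osterwalder–Schrader II, Ch. V, Method A, first stage — for fixed profiles): there is a function
`F` holomorphic on the tube `{∑ᵢ |Im zᵢ| < π/2}` over the `ℓ¹`-ball, bounded on every closed
sub-tube, such that for all Schwartz `ϑ₀, …, ϑ_k`

  `T(e^{-b·²}ϑ₀, …, e^{-b·²}ϑ_k) = ∫_{ℝ^{k+1}} F(x) ∏ᵢ ϑᵢ(xᵢ) dx`,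

where `T(θ) = ∫ (∏ᵢ logW b θᵢ(uᵢ)) 𝔖_{k+2}(⊗ⱼ φⱼ(· - aⱼ(w' + u) e₀)) du` is the skeleton functional —
i.e. `F(x) e^{2b∑xᵢ²}` is the density, in the variables `xᵢ = log(tᵢ - w')`, of the Schwinger
function of the skeleton cluster against windowed profiles of the gaps, and it continues
analytically to `{∑ᵢ |arg(tᵢ - w')| < π/2}`. Proof: the slot structure of this file and the flat
tube theorem `Literature.Analysis.Complex.exists_holomorphic_extension_l1Tube`. [cite: OsterwalderSchraderCMP1975, Ch. V pp. 291–292, Thm. 4.1 (A₀)] -/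
theorem exists_holomorphic_skelT (hE1 : 𝔖.IsEuclideanCovariant) (hE2 : 𝔖.IsOSReflectionPositive)
    (hφ : ∀ j, tsupport (φ j : EuclideanSpace ℝ (Fin d) → ℂ) ⊆ {y | |y 0| ≤ r}) (hw : 2 * r < w')
    (hw0 : 0 ≤ w') :
    ∃ F : (Fin (k + 1) → ℂ) → ℂ,
      DifferentiableOn ℂ F {z : Fin (k + 1) → ℂ | ∑ j, |(z j).im| < π / 2} ∧
      (∀ c : ℝ, c < π / 2 → ∃ K : ℝ, ∀ z : Fin (k + 1) → ℂ, ∑ j, |(z j).im| ≤ c → ‖F z‖ ≤ K) ∧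
      ∀ ϑ : Fin (k + 1) → 𝓢(ℝ, ℂ),
        skelT 𝔖 φ w' b (fun j (s : ℝ) => Complex.exp (-(b : ℂ) * (s : ℂ) ^ 2) * ϑ j s) =
          ∫ x : Fin (k + 1) → ℝ, F (fun j => (x j : ℂ)) * ∏ j, ϑ j (x j) := by
  -- the slot constants
  choose C N hC hCN using fun i : Fin (k + 1) => exists_norm_slotExt_le 𝔖 hE1 hE2 φ i hφ hw hw0
  exact Literature.Analysis.Complex.exists_holomorphic_extension_l1Tube (a := π / 2) (by positivity) hb
    (skelT 𝔖 φ w' b) (fun i θ _ => slotB i w' b (C i) (N i) θ)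
    (fun i θ => skelT_slot 𝔖 φ hr hb hE1 hE2 hφ hw hw0 i (hC i) (hCN i) θ)
    fun c _ => ⟨(Finset.univ : Finset (Fin (k + 1))).sup' Finset.univ_nonempty fun i =>
        slotB i w' b (C i) (N i) fun _ (s : ℝ) => Complex.exp (-(b : ℂ) * (s : ℂ) ^ 2), 0,
      fun i p => by
        rw [slotB_gaussMod_eq, pow_zero, mul_one]
        exact Finset.le_sup' (fun i => slotB i w' b (C i) (N i) fun _ (s : ℝ) =>
          Complex.exp (-(b : ℂ) * (s : ℂ) ^ 2)) (Finset.mem_univ i)⟩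

end Main

end Literature.MathematicalPhysics.QuantumFieldTheory
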